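import Summits.PneNP.PneNP.Theses.ExpanderLinearGenerators
import Summits.PneNP.PneNP.Theses.ProofCplx
import Summits.PneNP.PneNP.Theorems.ExpanderLinearGeneratorsNoPolyBoundedProofSystemLadder
import Summits.PneNP.PneNP.Theorems.ProofCplxProofcplxGeneratorImpliesNPNeCoNP
import Literature.Computability.Complexity.StructuralPHProofs

/-!
# Ideator-5 sketch for crux `ProofcplxThesis` / `NoPolyBoundedProofSystem` (stmt-PneNP-0097)

Seat `planner-cruxidea-stmt-PneNP-0097-5-0` (crux-ideate, round 2). Companion of
`Cruxes/ProofcplxThesis/IDEATOR5-NOTES.md` §4 ("Post's programme node").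

Kernel-checked content (no `sorry`):

* `PHSimple`  — "the polynomial hierarchy contains an infinite `NP`-immune language"
  (the complexity-theoretic analogue of a Post SIMPLE set, Homer–Maass 1983 / Balcázar 1985,
  relaxed from `coNP` to `PH`);
* `X_of_phSimple : PHSimple → X` — a NEW NODE strictly between the two ProofCplx cruxes:
  `ProofcplxKrajicekGenerator (stmt-PneNP-0111) → CoNPSimple → PHSimple → X (stmt-PneNP-0097)`;
* `coNPSimple_of_krajicekGenerator` — Krajíček's conjecture says exactly that the co-range of a
  p-time one-bit-stretching map is `NP`-SIMPLE (in `coNP`, infinite, no infinite `NP` subset).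

Why it is recorded (and why it is NOT filed as a crux idea): see IDEATOR5-NOTES.md §4 — every
in-PH construction of an `NP`-immune set meets the CLOCK WALL (a single `Σₖ`-machine has a fixed
polynomial budget and cannot out-run all `NTIME(n^c)` opponents; per-clock immune sets exist by
delayed diagonalisation and prove nothing), so `PHSimple` keeps the universal quantifier over
polynomial-time devices that the census (STRATEGY-CENSUS §Strengthen) identifies as the crux.
-/

set_option linter.dupNamespace false

namespace Summit.PneNP.PneNP.Cruxes.ProofcplxThesis.Ideator5

open Literature.Computability.Complexity Literature.Computability.MetaComplexity
open Summit.PneNP.PneNP.Theses Summit.PneNP.PneNP.Theorems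

/-- The crux, by its route name. -/
abbrev X : Prop := ExpanderLinearGenerators.NoPolyBoundedProofSystem

/-- `A` is `NP`-immune: it has no infinite `NP` subset. [Balcázar–Schöning 1985; folklore] -/
def NPImmune (A : Language Bool) : Prop :=
  ∀ W ∈ Nondeterministic.NP, W ≤ A → W.Finite

/-- **Post's programme node (PH form).** Some infinite language in the polynomial hierarchy is
`NP`-immune. -/
def PHSimple : Prop :=
  ∃ A : Language Bool, A ∈ PH ∧ A.Infinite ∧ NPImmune A

/-- **`NP`-simple sets exist** (Homer–Maass 1983, Balcázar 1985): some `NP` language has an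
infinite `NP`-immune complement; stated on the complement `A ∈ coNP`. -/
def CoNPSimple : Prop :=
  ∃ A : Language Bool, Aᶜ ∈ Nondeterministic.NP ∧ A.Infinite ∧ NPImmune A

/-- `coNP ⊆ PH`, so an `NP`-simple set gives the `PH` node. -/
theorem phSimple_of_coNPSimple (h : CoNPSimple) : PHSimple := by
  obtain ⟨A, hAc, hinf, himm⟩ := h
  refine ⟨A, ?_, hinf, himm⟩
  have h1 : Aᶜ ∈ SigmaP 1 := by
    rw [(SigmaP_one_holds : SigmaP 1 = Nondeterministic.NP)]
    exact hAc
  have h2 : (Aᶜ)ᶜ ∈ PiP 1 := compl_mem_PiP_iff.2 h1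
  rw [compl_compl] at h2
  exact PiP_subset_PH 1 h2

/-- **The node implies the crux.** If `X` fails then `PH = NP` (Cook–Reckhow + Stockmeyer, tree:
`PH_eq_NP_of_not_noPolyBoundedProofSystem`), so the immune set `A ∈ PH = NP` is an infinite `NP`
subset of itself — contradiction. -/
theorem X_of_phSimple (h : PHSimple) : X := by
  obtain ⟨A, hA, hinf, himm⟩ := h
  by_contra hX
  have hPH : PH = Nondeterministic.NP := PH_eq_NP_of_not_noPolyBoundedProofSystem hX
  rw [hPH] at hA
  exact hinf (himm A hA le_rfl)

theorem X_of_coNPSimple (h : CoNPSimple) : X :=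
  X_of_phSimple (phSimple_of_coNPSimple h)

/-- **Krajíček's conjecture is an `NP`-simplicity statement**: the co-range of a polynomial-time
one-bit-stretching map whose range meets every infinite `NP` set is in `coNP`, infinite
(pigeonhole), and `NP`-immune (verbatim the hitting hypothesis). So crux #2 of route ProofCplx
(stmt-PneNP-0111) factors through `CoNPSimple → PHSimple → X`. [cite: Krajicek2022, §1 (p. 4)] -/
theorem coNPSimple_of_krajicekGenerator (h : ProofCplx.ProofcplxKrajicekGenerator) : CoNPSimple := by
  obtain ⟨g, hg, hlen, hhit⟩ := h
  refine ⟨(Set.range g)ᶜ, ?_, compl_range_infinite_of_stretching hlen, ?_⟩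
  · rw [compl_compl]
    exact range_mem_NP_of_stretching hg hlen
  · intro W hW hWsub
    by_contra hWinf
    obtain ⟨x, hx⟩ := hhit W hW hWinf
    exact hWsub hx ⟨x, rfl⟩

/-- The chain `0111 → node → 0097`, assembled. -/
theorem X_of_krajicekGenerator_via_node (h : ProofCplx.ProofcplxKrajicekGenerator) : X :=
  X_of_coNPSimple (coNPSimple_of_krajicekGenerator h)

end Summit.PneNP.PneNP.Cruxes.ProofcplxThesis.Ideator5
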